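import Literature.Geometry.Lorentzian.AFEndRestrict
import Literature.Geometry.Lorentzian.AsymptoticallyFlatCompleteness
import HarnessLib

/-!
# The sections of an initial data set on an end are pullbacks of its chart components along `coord`

A short support file (topic `Geometry/Lorentzian`; everything PROVED). For an asymptotically flat
end `e` of the `3`-manifold `X` and an initial data set `d` on `X`:

* `pullbackBilin_comp_apply'` — the **pointwise chain rule** `((g ∘ f)^* b)_y = (f^*(g^* b))_y` for
  pullbacks of fields of bilinear forms (O'Neill 1983, Ch. 3, p. 58), and
  `pullbackBilin_congr_of_eventuallyEq` — the pullback at `y` only depends on the germ of the map;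
* `heq_mfderiv_dataChartExt_comp_mfderiv_coord` — `dΦₑ ∘ dcoord = id` on the end;
* `h_inner_eq_pullbackBilin_coord`, `k_eq_pullbackBilin_coord` — **on the end,
  `h_d = coord^*(hCoeff e d)` and `k_d = coord^*(kCoeff e d)`**: the sections of `d` are the
  pullbacks along the coordinate function of their own chart components, read as fields of bilinear
  forms on `ℝ³` (Bartnik 1986, (1.3)).

Used to compare data through their chart components (exact model ends, patching, breathing).

## References

* R. Bartnik, *The mass of an asymptotically flat manifold*, CPAM 39 (1986), §1, (1.3). [Bartnik1986]
* B. O'Neill, *Semi-Riemannian geometry* (1983), Ch. 3, p. 58. [ONeill1983]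
-/

noncomputable section

open Bundle Set Filter TopologicalSpace Function
open scoped Manifold ContDiff Topology

namespace Literature.Geometry.Lorentzian

/-! ### Pullback calculus (pointwise chain rule, dependence on the germ of the map) -/

section PullbackCalculus

variable {EN : Type*} [NormedAddCommGroup EN] [NormedSpace ℝ EN] {HN : Type*} [TopologicalSpace HN]
  {IN : ModelWithCorners ℝ EN HN} {N : Type*} [TopologicalSpace N] [ChartedSpace HN N]
  {EM : Type*} [NormedAddCommGroup EM] [NormedSpace ℝ EM] {HM : Type*} [TopologicalSpace HM]
  {IM : ModelWithCorners ℝ EM HM} {M : Type*} [TopologicalSpace M] [ChartedSpace HM M]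
  {EP : Type*} [NormedAddCommGroup EP] [NormedSpace ℝ EP] {HP : Type*} [TopologicalSpace HP]
  {IP : ModelWithCorners ℝ EP HP} {P : Type*} [TopologicalSpace P] [ChartedSpace HP P]

/-- **Pointwise chain rule for pullbacks**: `((g ∘ f)^* b)_y = (f^*(g^* b))_y` when `f` is
differentiable at `y` and `g` at `f y`. [cite: ONeill1983, Ch. 3, p. 58] -/
theorem pullbackBilin_comp_apply' {f : N → M} {g : M → P} {y : N}
    (hg : MDifferentiableAt IM IP g (f y)) (hf : MDifferentiableAt IN IM f y)
    (b : Π z : P, TangentSpace IP z →L[ℝ] TangentSpace IP z →L[ℝ] ℝ) :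
    pullbackBilin (I := IP) (I' := IN) (g ∘ f) b y =
      pullbackBilin (I := IM) (I' := IN) f (pullbackBilin (I := IP) (I' := IM) g b) y := by
  ext v w
  simp only [pullbackBilin_apply, Function.comp_apply]
  rw [mfderiv_comp y hg hf]
  rfl

/-- **The pullback at `y` only depends on the germ of the map at `y`.** [cite: ONeill1983, Ch. 3, Def. 3.9] -/
theorem pullbackBilin_congr_of_eventuallyEq {f f' : N → M} {y : N} (h : f =ᶠ[𝓝 y] f')
    (b : Π z : M, TangentSpace IM z →L[ℝ] TangentSpace IM z →L[ℝ] ℝ) :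
    pullbackBilin (I := IM) (I' := IN) f b y = pullbackBilin (I := IM) (I' := IN) f' b y := by
  have hpt : f y = f' y := h.eq_of_nhds
  have hd : mfderiv IN IM f y = mfderiv IN IM f' y := h.mfderiv_eq
  have key : ∀ (p : M) (_ : p = f' y) (L : TangentSpace IN y →L[ℝ] TangentSpace IM p)
      (_ : ∀ v, HEq (L v) (mfderiv IN IM f' y v)) (v w : TangentSpace IN y),
      b p (L v) (L w) = b (f' y) (mfderiv IN IM f' y v) (mfderiv IN IM f' y w) := by
    rintro p rfl L hL v w
    rw [eq_of_heq (hL v), eq_of_heq (hL w)]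
  ext v w
  rw [pullbackBilin_apply, pullbackBilin_apply]
  exact key _ hpt _ (fun v ↦ heq_of_eq (by rw [hd]; rfl)) v w

end PullbackCalculus

/-! ### The sections of `d` on the end as pullbacks along `coord` -/

namespace AFEnd

variable {X : Type} [TopologicalSpace X] [ChartedSpace E3 X] {e : AFEnd X}

/-- `dΦₑ (dcoord v) = v` on the end (`Φₑ ∘ coord = id` there). [cite: Bartnik1986, §1] -/
theorem heq_mfderiv_dataChartExt_comp_mfderiv_coord {y : X} (hy : y ∈ e.U) (v : TangentSpace (𝓡 3) y) :
    HEq (((mfderiv 𝓘(ℝ, E3) (𝓡 3) e.dataChartExt (e.coord y)).comp (mfderiv (𝓡 3) 𝓘(ℝ, E3) e.coord y)) v) v := by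
  have h := e.mfderiv_dataChart_mfderiv_chart ⟨y, hy⟩ v
  rw [← e.mfderiv_coord_comp_val ⟨y, hy⟩, e.mfderiv_dataChart_eq] at h
  have hc : ((e.chart ⟨y, hy⟩ : exteriorRegion e.R) : E3) = e.coord y := (e.coord_of_mem hy).symm
  rw [hc] at h
  exact heq_of_eq h

variable [IsManifold (𝓡 3) ∞ X] (d : InitialDataSet (𝓡 3) X)

/-- **On the end, `h_d = coord^* (hCoeff e d)`**: the metric of an initial data set is the pullback
along the coordinate function of its own chart components (read as a field of bilinear forms on
`ℝ³`). [cite: Bartnik1986, (1.3)] -/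
theorem h_inner_eq_pullbackBilin_coord {y : X} (hy : y ∈ e.U) :
    d.h.inner y = pullbackBilin (I := 𝓘(ℝ, E3)) (I' := 𝓡 3) e.coord
      (show Π z : E3, TangentSpace 𝓘(ℝ, E3) z →L[ℝ] TangentSpace 𝓘(ℝ, E3) z →L[ℝ] ℝ from hCoeff e d) y := by
  have hz : e.R < ‖e.coord y‖ := e.lt_norm_coord hy
  have hpt : e.dataChartExt (e.coord y) = y := by
    rw [e.dataChartExt_of_lt hz, e.dataChart_coord hy]
  have key : ∀ (p : X) (_ : p = y) (L : TangentSpace (𝓡 3) y →L[ℝ] TangentSpace (𝓡 3) p)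
      (_ : ∀ v, HEq (L v) v) (v w : TangentSpace (𝓡 3) y), d.h.inner p (L v) (L w) = d.h.inner y v w := by
    rintro p rfl L hL v w
    rw [eq_of_heq (hL v), eq_of_heq (hL w)]
  ext v w
  rw [pullbackBilin_apply]
  change d.h.inner y v w = hCoeff e d (e.coord y) (mfderiv (𝓡 3) 𝓘(ℝ, E3) e.coord y v)
    (mfderiv (𝓡 3) 𝓘(ℝ, E3) e.coord y w)
  rw [e.hCoeff_apply_eq_dataChartExt d hz]
  exact (key _ hpt _ (heq_mfderiv_dataChartExt_comp_mfderiv_coord hy) v w).symm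

/-- **On the end, `k_d = coord^* (kCoeff e d)`.** [cite: ChristodoulouKlainerman1993, (1.0.9)] -/
theorem k_eq_pullbackBilin_coord {y : X} (hy : y ∈ e.U) :
    d.k y = pullbackBilin (I := 𝓘(ℝ, E3)) (I' := 𝓡 3) e.coord
      (show Π z : E3, TangentSpace 𝓘(ℝ, E3) z →L[ℝ] TangentSpace 𝓘(ℝ, E3) z →L[ℝ] ℝ from kCoeff e d) y := by
  have hz : e.R < ‖e.coord y‖ := e.lt_norm_coord hy
  have hpt : e.dataChartExt (e.coord y) = y := by
    rw [e.dataChartExt_of_lt hz, e.dataChart_coord hy]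
  have key : ∀ (p : X) (_ : p = y) (L : TangentSpace (𝓡 3) y →L[ℝ] TangentSpace (𝓡 3) p)
      (_ : ∀ v, HEq (L v) v) (v w : TangentSpace (𝓡 3) y), d.k p (L v) (L w) = d.k y v w := by
    rintro p rfl L hL v w
    rw [eq_of_heq (hL v), eq_of_heq (hL w)]
  ext v w
  rw [pullbackBilin_apply]
  change d.k y v w = kCoeff e d (e.coord y) (mfderiv (𝓡 3) 𝓘(ℝ, E3) e.coord y v)
    (mfderiv (𝓡 3) 𝓘(ℝ, E3) e.coord y w)
  rw [e.kCoeff_apply_eq_dataChartExt d hz]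
  exact (key _ hpt _ (heq_mfderiv_dataChartExt_comp_mfderiv_coord hy) v w).symm


end AFEnd

end Literature.Geometry.Lorentzian

end
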